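import Mathlib
import Literature.AlgebraicGeometry.Resolution.NormalAscent

/-!
# `SectionCriterion` (stmt-ResolutionOfSingularities-15962), helper: saturation lemmas for the strict transform of the generic member

Route `ResolutionOfSingularities/SectionAscent`, support item `SectionCriterion` (the section criterion at
the generic level). Commutative-algebra helpers used to identify the chart ring of the blowing up of the
generic member `Spec ((K(t) ⊗_K A) ⧸ (ℓ))` along `I` with the quotient of `A[I/g] ⊗_K K(t)` by the local
equation `x₁ = ℓ/g` (the saturation `((x₁) : g^∞)` is `(x₁)`):

* `mem_span_singleton_of_mul_mem_of_height` — in a normal Noetherian domain, `(x : g) = (x)` as soon as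
  every prime containing `x` and `g` has height `≥ 2`;
* `one_lt_height_of_C_mem_of_coeff_notMem`, `isIntegrallyClosed_mvPolynomial_fin`,
  `mem_span_singleton_of_C_pow_mul_mem` — the polynomial-ring instances used for
  `x₁ = Σ X_j u_j ∈ A'[X]` with a unit coefficient.

Proved by the wave-1 stub-worker of line `registered` of crux `GenericLevel` (stmt-…-15959); everything is
sorry-free, no named facts. [folklore] throughout (Matsumura, *Commutative Ring Theory*, Thm 11.5 /
§17 for the normal case).
-/

set_option linter.dupNamespace false

open IsLocalRing

namespace Summit.ResolutionOfSingularities.ResolutionOfSingularities.Theorems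

/-- **Principal ideals of a normal Noetherian domain have no embedded components** (the `(S₂)`
half of Serre's criterion, Stacks 031S, in the form needed here): if `x ≠ 0`, `g m ∈ (x)` and
every prime containing `x` and `g` has height `≥ 2`, then `m ∈ (x)`. Otherwise an associated
prime `𝔮 ⊇ ((x) : m) ∋ g` of `R/(x)` localizes to a normal local domain whose maximal ideal is
associated to `R_𝔮/(x)`, hence principal (tree `maximalIdeal_isPrincipal_of_mul_mem_span`), so
`ht 𝔮 ≤ 1` by Krull's principal ideal theorem. [cite: StacksProject, Tag 031S] -/
theorem mem_span_singleton_of_mul_mem_of_height {R : Type*} [CommRing R] [IsDomain R]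
    [IsNoetherianRing R] [IsIntegrallyClosed R] {x g m : R} (hx : x ≠ 0)
    (hgm : g * m ∈ Ideal.span {x})
    (H : ∀ 𝔮 : Ideal R, 𝔮.IsPrime → x ∈ 𝔮 → g ∈ 𝔮 → 1 < 𝔮.height) :
    m ∈ Ideal.span {x} := by
  classical
  by_contra hm
  let M := R ⧸ Ideal.span {x}
  have hm0 : (Ideal.Quotient.mk (Ideal.span {x}) m : M) ≠ 0 := fun h =>
    hm (Ideal.Quotient.eq_zero_iff_mem.mp h)
  obtain ⟨𝔮, hass, hle⟩ := exists_le_isAssociatedPrime_of_isNoetherianRing R _ hm0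
  obtain ⟨h𝔮, ybar, hybar⟩ := (isAssociatedPrime_iff (I := 𝔮) (M := M)).mp hass
  haveI := h𝔮
  obtain ⟨y, rfl⟩ := Ideal.Quotient.mk_surjective ybar
  -- `c ∈ 𝔮 ↔ c y ∈ (x)`
  have hann : ∀ c : R, c ∈ 𝔮 ↔ c * y ∈ Ideal.span {x} := by
    intro c
    rw [hybar, Submodule.mem_colon_singleton, Submodule.mem_bot, Algebra.smul_def,
      Ideal.Quotient.algebraMap_eq, ← map_mul, Ideal.Quotient.eq_zero_iff_mem]
  have hxq : x ∈ 𝔮 := (hann x).mpr (Ideal.mul_mem_right _ _ (Ideal.mem_span_singleton_self x))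
  have hgq : g ∈ 𝔮 := by
    apply hle
    rw [Submodule.mem_colon_singleton, Submodule.mem_bot, Algebra.smul_def,
      Ideal.Quotient.algebraMap_eq, ← map_mul, Ideal.Quotient.eq_zero_iff_mem]
    exact hgm
  have hy : y ∉ Ideal.span {x} := by
    intro hy
    apply h𝔮.ne_top
    rw [Ideal.eq_top_iff_one, hann, one_mul]
    exact hy
  -- localize at `𝔮`
  let Rq := Localization.AtPrime 𝔮
  haveI : IsIntegrallyClosed Rq :=
    isIntegrallyClosed_of_isLocalization Rq 𝔮.primeCompl 𝔮.primeCompl_le_nonZeroDivisors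
  have hinj : Function.Injective (algebraMap R Rq) :=
    IsLocalization.injective Rq 𝔮.primeCompl_le_nonZeroDivisors
  have ha₁ : algebraMap R Rq x ∈ maximalIdeal Rq :=
    (IsLocalization.AtPrime.to_map_mem_maximal_iff Rq 𝔮 x).mpr hxq
  have ha₂ : algebraMap R Rq x ≠ 0 := fun h => hx (hinj (by rw [h, map_zero]))
  have hb₂ : algebraMap R Rq y ∉ Ideal.span {algebraMap R Rq x} := by
    intro h
    rw [Ideal.mem_span_singleton'] at h
    obtain ⟨k, hk⟩ := h
    obtain ⟨⟨r, s⟩, hrs⟩ := IsLocalization.surj 𝔮.primeCompl k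
    -- `k = r/s`, so `r x = y s`
    have h1 : algebraMap R Rq (r * x) = algebraMap R Rq (y * s) := by
      rw [map_mul, map_mul, ← hrs, mul_assoc, mul_comm (algebraMap R Rq s) _, ← mul_assoc, hk]
    have h2 : r * x = y * s := hinj h1
    have h3 : (s : R) ∈ 𝔮 := by
      rw [hann, mul_comm, ← h2]
      exact Ideal.mul_mem_left _ _ (Ideal.mem_span_singleton_self x)
    exact s.2 h3
  have hb₃ : ∀ m' ∈ maximalIdeal Rq, ∃ k : Rq, k * algebraMap R Rq x = algebraMap R Rq y * m' := by
    intro m' hm'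
    rw [← Localization.AtPrime.map_eq_maximalIdeal, IsLocalization.mem_map_algebraMap_iff
      𝔮.primeCompl] at hm'
    obtain ⟨⟨⟨r, hr⟩, s⟩, hrs⟩ := hm'
    obtain ⟨k₀, hk₀⟩ := Ideal.mem_span_singleton'.mp ((hann r).mp hr)
    -- `k₀ x = r y`; `m' s = r`
    obtain ⟨u, hu⟩ := IsLocalization.map_units Rq s
    refine ⟨algebraMap R Rq k₀ * ↑u⁻¹, ?_⟩
    have hm'eq : m' = algebraMap R Rq r * ↑u⁻¹ := by
      rw [← hrs]
      change m' = m' * algebraMap R Rq s * ↑u⁻¹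
      rw [← hu, mul_assoc, Units.mul_inv, mul_one]
    rw [hm'eq, mul_right_comm, ← map_mul, hk₀, map_mul]
    ring
  have hprinc : (maximalIdeal Rq).IsPrincipal :=
    Literature.AlgebraicGeometry.Resolution.maximalIdeal_isPrincipal_of_mul_mem_span ha₁ ha₂ hb₂ hb₃
  -- Krull: `ht 𝔪 ≤ 1`, but `ht 𝔪 = ht 𝔮 ≥ 2`
  have hle1 : (maximalIdeal Rq).height ≤ 1 :=
    Ideal.height_le_one_of_isPrincipal_of_mem_minimalPrimes (maximalIdeal Rq) (maximalIdeal Rq)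
      (by rw [Ideal.minimalPrimes_eq_subsingleton_self]; exact Set.mem_singleton _)
  have heq : (maximalIdeal Rq).height = 𝔮.height := by
    rw [← IsLocalization.height_under 𝔮.primeCompl (maximalIdeal Rq),
      Localization.AtPrime.under_maximalIdeal]
  have hlt := H 𝔮 h𝔮 hxq hgq
  rw [← heq] at hlt
  exact absurd hle1 (not_le.mpr hlt)

open MvPolynomial in
/-- In `A'[X_σ]` (`A'` a Noetherian domain): a prime `𝔮` containing a nonzero constant `g'` and a
polynomial `x₁` with some coefficient outside `𝔮 ∩ A'` has height `≥ 2` — it lies strictly above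
the nonzero prime `(𝔮 ∩ A') A'[X]`. [folklore] -/
theorem one_lt_height_of_C_mem_of_coeff_notMem {A' : Type*} [CommRing A'] [IsDomain A']
    [IsNoetherianRing A'] {σ : Type*} [Finite σ] (𝔮 : Ideal (MvPolynomial σ A')) [𝔮.IsPrime]
    {g' : A'} (hg' : g' ≠ 0) (hg𝔮 : C g' ∈ 𝔮) {x₁ : MvPolynomial σ A'} (hx𝔮 : x₁ ∈ 𝔮)
    {d : σ →₀ ℕ} (hd : coeff d x₁ ∉ 𝔮.comap (C : A' →+* MvPolynomial σ A')) :
    1 < 𝔮.height := by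
  set 𝔮₀ := 𝔮.comap (C : A' →+* MvPolynomial σ A') with h𝔮₀
  haveI : 𝔮₀.IsPrime := Ideal.IsPrime.comap C
  set P₁ : Ideal (MvPolynomial σ A') := 𝔮₀.map C with hP₁def
  have hP₁ : P₁ = RingHom.ker (map (Ideal.Quotient.mk 𝔮₀) :
      MvPolynomial σ A' →+* MvPolynomial σ (A' ⧸ 𝔮₀)) := by
    rw [ker_map, Ideal.mk_ker]
  haveI : P₁.IsPrime := hP₁ ▸ RingHom.ker_isPrime _
  have hbot : (⊥ : Ideal (MvPolynomial σ A')) < P₁ := by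
    refine bot_lt_iff_ne_bot.mpr fun h => hg' ?_
    have : C g' ∈ P₁ := Ideal.mem_map_of_mem _ (show g' ∈ 𝔮₀ from hg𝔮)
    rw [h, Ideal.mem_bot, C_eq_zero] at this
    exact this
  have hlt : P₁ < 𝔮 := by
    refine lt_of_le_of_ne (Ideal.map_le_iff_le_comap.mpr le_rfl) fun h => hd ?_
    rw [← h] at hx𝔮
    exact (mem_map_C_iff.mp hx𝔮) d
  have h1 : (⊥ : Ideal (MvPolynomial σ A')).height < P₁.height :=
    Ideal.height_strict_mono_of_isPrime hbot
  have h2 : P₁.height < 𝔮.height := Ideal.height_strict_mono_of_isPrime hlt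
  rw [Ideal.height_bot] at h1
  calc (1 : ℕ∞) ≤ P₁.height := Order.one_le_iff_ne_zero.mpr h1.ne'
    _ < 𝔮.height := h2

open MvPolynomial in
/-- `A'[X₁, …, X_m]` is integrally closed for an integrally closed domain `A'`. [folklore] -/
theorem isIntegrallyClosed_mvPolynomial_fin {A' : Type*} [CommRing A'] [IsDomain A']
    [IsIntegrallyClosed A'] : ∀ m : ℕ, IsIntegrallyClosed (MvPolynomial (Fin m) A')
  -- adapted from Literature/AlgebraicGeometry/Motives/CurveThroughTwoPointsHypersurfaceModel.lean
  | 0 => IsIntegrallyClosed.of_equiv (MvPolynomial.isEmptyAlgEquiv A' (Fin 0)).symm.toRingEquiv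
  | m + 1 => by
    haveI := isIntegrallyClosed_mvPolynomial_fin (A' := A') m
    exact IsIntegrallyClosed.of_equiv (MvPolynomial.finSuccEquiv A' m).symm.toRingEquiv

open MvPolynomial in
/-- **Saturation.** For an integrally closed Noetherian domain `A'`, a prime `𝔔₀` of
`D = A'[X₀, …, X_{s-1}]`, a nonzero constant `g'` and a polynomial `x₁` with a coefficient `1`:
in `R = D_{𝔔₀}` the principal ideal `(x₁)` is `g'`-saturated, `((x₁) : g'^N) = (x₁)`
(every prime of `R` containing `x₁` and `g'` has height `≥ 2`, and principal ideals of the normal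
domain `R` have no embedded primes). [cite: StacksProject, Tag 031S] -/
theorem mem_span_singleton_of_C_pow_mul_mem {A' : Type*} [CommRing A'] [IsDomain A']
    [IsNoetherianRing A'] [IsIntegrallyClosed A'] {s : ℕ}
    (𝔔₀ : Ideal (MvPolynomial (Fin s) A')) [𝔔₀.IsPrime] {g' : A'} (hg' : g' ≠ 0)
    {x₁ : MvPolynomial (Fin s) A'} {d : Fin s →₀ ℕ} (hd : coeff d x₁ = 1) :
    ∀ (N : ℕ) (m : Localization.AtPrime 𝔔₀),
      algebraMap (MvPolynomial (Fin s) A') (Localization.AtPrime 𝔔₀) (C g') ^ N * m ∈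
        Ideal.span {algebraMap (MvPolynomial (Fin s) A') (Localization.AtPrime 𝔔₀) x₁} →
      m ∈ Ideal.span {algebraMap (MvPolynomial (Fin s) A') (Localization.AtPrime 𝔔₀) x₁} := by
  haveI : IsIntegrallyClosed (MvPolynomial (Fin s) A') := isIntegrallyClosed_mvPolynomial_fin s
  haveI : IsIntegrallyClosed (Localization.AtPrime 𝔔₀) :=
    isIntegrallyClosed_of_isLocalization (Localization.AtPrime 𝔔₀) 𝔔₀.primeCompl
      𝔔₀.primeCompl_le_nonZeroDivisors
  have hinj : Function.Injective
      (algebraMap (MvPolynomial (Fin s) A') (Localization.AtPrime 𝔔₀)) :=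
    IsLocalization.injective (Localization.AtPrime 𝔔₀) 𝔔₀.primeCompl_le_nonZeroDivisors
  have hx0 : algebraMap (MvPolynomial (Fin s) A') (Localization.AtPrime 𝔔₀) x₁ ≠ 0 := by
    intro h
    have hx : x₁ = 0 := hinj (by rw [h, map_zero])
    have := congrArg (coeff d) hx
    rw [hd, coeff_zero] at this
    exact one_ne_zero this
  -- every prime of `R` containing `x₁` and `g'` has height `≥ 2`
  have H : ∀ 𝔮 : Ideal (Localization.AtPrime 𝔔₀), 𝔮.IsPrime →
      algebraMap (MvPolynomial (Fin s) A') (Localization.AtPrime 𝔔₀) x₁ ∈ 𝔮 →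
      algebraMap (MvPolynomial (Fin s) A') (Localization.AtPrime 𝔔₀) (C g') ∈ 𝔮 →
      1 < 𝔮.height := by
    intro 𝔮 h𝔮 hx hg
    rw [← IsLocalization.height_under 𝔔₀.primeCompl 𝔮]
    haveI : (𝔮.under (MvPolynomial (Fin s) A')).IsPrime := Ideal.IsPrime.under _ 𝔮
    refine one_lt_height_of_C_mem_of_coeff_notMem (𝔮.under (MvPolynomial (Fin s) A')) hg' hg hx
      (d := d) ?_
    rw [hd]
    exact (Ideal.ne_top_iff_one _).mp (Ideal.IsPrime.ne_top inferInstance)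
  intro N
  induction N with
  | zero => intro m hm; simpa using hm
  | succ N ih =>
    intro m hm
    apply ih
    apply mem_span_singleton_of_mul_mem_of_height hx0
      (g := algebraMap (MvPolynomial (Fin s) A') (Localization.AtPrime 𝔔₀) (C g')) _ H
    rw [← mul_assoc, ← pow_succ']
    exact hm

end Summit.ResolutionOfSingularities.ResolutionOfSingularities.Theorems
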